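import Literature.NumberTheory.EllipticCurves.KuriharaNumberKimShaLength
import HarnessLib

/-!
# Kim's structure theorem, clause (6): the PROOF-COVERED twins of the four unit-Kurihara-number facts,
# with the binder `E(ℚ_p)[p] = 0` (`t = 0`)

Topic `NumberTheory/EllipticCurves`; namespace `Literature.NumberTheory.EllipticCurves`. Sibling of
`KuriharaNumberKimShaLength` (whose four named facts B5–B8 of the ARM P register stay byte-identical,
now flagged `K26-(6)-shallow@t>0`). Written by the BSD cited-literature audit (ARM P, `pub/bsd-cited`),
typer seat bsd-cited-ty2, on the finding F2 of reader bsd-cited-r10 (sheet `D-AUDIT-r10.md` sha16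
cfa522325b7b7321 §D.2, adopted by the programme lead 18:10:47Z 2026-08-26 as STRONGER-THAN-PROOF ⇒
narrow; TY-QUEUE 11).

## The finding (r10 §D.2, locators on the held text arXiv:2203.12159)

C.-H. Kim, Amer. J. Math. 148 (2026) 79–129, Thm. 1.8 (= arXiv Thm. 1.9) (6):
`length_{ℤ_p} Ш(E/ℚ)[p^∞] = ∂^{(ord(δ̃))}(δ̃) − ∂^{(∞)}(δ̃)`, with `∂^{(∞)} = lim_k` of §1.5.1
(p0007:L78–L80, "Note that lim … is well-defined under our running hypotheses" — asserted). Write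
`t := ord_p #E(ℚ_p)[p^∞]`. The proof controls the images `x_n = u · p^t · δ̃_n ∈ ℤ_p/I_n = ℤ/p^{k(n)}`
(Thm. 3.13, p0017:L134) at DEEP levels ("`k` sufficiently large", p0025:L7; §5.4.3 "`j = ord_p(δ̃_{ℓ₁ℓ₂})
+ t`", p0024:L110–L119); at a level `n` with `k(n) ≤ t` one has `x_n = 0` for EVERY value of `δ̃_n`,
so a Kurihara number non-zero at depth `k ≤ t` does not bound the deep invariant through the displayed
argument. At `t = 0`, `x_n = u · δ̃_n` exactly and "all levels = deep levels". By Prop. 3.2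
(p0015:L56–L76) `t ≥ 1` iff `p` is good anomalous ordinary with a local `p`-torsion point, or split
multiplicative with `p ∣ ord_p(j)`, or additive `p ∈ {5, 7}` on two congruence classes; on every
consumer row `t ≤ 1`, so the exposure of the LEVEL-ONE certificate facts B5–B8 is exactly the `t = 1`
rows. The four `Prop`s below are B5–B8 with ONE extra binder, inserted after the surjectivity binder:

  `Nat.card {Q : (W.baseChange ℚ_[p]).toAffine.Point // (p : ℕ) • Q = 0} = 1 →`

("`E(ℚ_p)[p] = 0`", i.e. `t = 0`; byte-identical in shape to the `(t0)` binder of the cell theorem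
`N11.KimAtThreeRankZeroPUB` at `p = 3`, and equivalent to the binder
`∀ P, (p : ℤ) • P = 0 → P = 0` of `Kim2022_kuriharaNumber_certificate` /
`Kim2022_exists_kuriharaNumber_modP_ne_zero` — `natCard_localPTorsion_eq_one_iff` below, proved).
Under this binder the printed proof covers the statement at every level (r10 §D.2; the cell's own
`p = 3` standard KIM3-PROOF v2.2 E5 / §16 Cor C-t reads the same way). Everything else — statement
shape, cites, "weaker than print" status — is as in the sibling file; the old facts imply the twins
(bridges `…_of_localTorsionTrivial_of`, proved), so consumers on `t = 0` rows re-point at no cost.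

## Contents
* `natCard_localPTorsion_eq_one_iff` (proved): the `(t0)` binder ⟺ `∀ P, (p : ℤ) • P = 0 → P = 0`.
* `Kim2022_rankZero_padicValRat_sha_of_kuriharaNumber_ne_zero_of_localTorsionTrivial` (B5 twin),
  `Kim2022_rankOne_card_sha_eq_one_of_kuriharaNumber_ne_zero_of_localTorsionTrivial` (B6 twin),
  `Kim2022_rankZero_padicValRat_sha_of_kuriharaNumber_ne_zero_of_maninConstant_of_localTorsionTrivial`
  (B7 twin), `Kim2022_rankOne_card_sha_eq_one_of_kuriharaNumber_ne_zero_of_maninConstant_of_localTorsionTrivial`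
  (B8 twin) — named facts (`def … : Prop`, nothing asserted; no `_holds`, size XL as their siblings);
* the four bridges old ⇒ twin (proved, one line each).
* `Kim2022_rankZero_padicValRat_sha_of_kuriharaNumber_ne_zero_of_maninConstant_depthTwo` (B7 DEPTH-TWO
  twin, TY-QUEUE 11c; appended 2026-08-26 on r10's ADDENDUM-2 sha16 2c7193b026c59569): B7 with the binder
  `#E(ℚ_p)[p²] ≤ p` ("`t ≤ 1`") and the level deepened to `𝒩_2` — the form that consumes a LEVEL-TWO
  certificate on a `t = 1` row (referee A R351.5's exit binder); bridge B7 ⇒ depth-two twin proved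
  (`Kato.IsKolyvaginProduct.mono`).

## References
* C.-H. Kim, Amer. J. Math. 148 (2026) 79–129 = arXiv:2203.12159: Thm. 1.9 (= journal Thm. 1.8) (1),
  (4), (6); Cor. 1.6; §1.3.5; §1.4.1–1.4.4; §1.5.1; Prop. 3.2; Lemma 3.10; Thm. 3.13; §5.4.3.
  [Kim2022StructureSelmer]
* B. Mazur, Invent. Math. 44 (1978), Cor. 4.1. [Mazur1978]
* R. Greenberg, V. Vatsal, Invent. Math. 142 (2000), §3, Rem. 3.4. [GreenbergVatsal2000]
* C.-H. Kim, K. Nakamura, J. Number Theory 210 (2020), Thm. 1.7. [KimNakamura2020]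
-/

noncomputable section

open scoped MatrixGroups ModularForm Classical

open CongruenceSubgroup Literature.NumberTheory.EllipticCurves.ModularForms

namespace Literature.NumberTheory.EllipticCurves

/-- **The `(t0)` binder in two spellings**: `#E(ℚ_p)[p] = 1` iff every `ℚ_p`-point killed by `p` is
zero (Kim, Amer. J. Math. 148 (2026), Prop. 3.2: the locus `E(ℚ_p)[p] ≠ 0`; the binder
`∀ P, (p : ℤ) • P = 0 → P = 0` is the one of `Kim2022_kuriharaNumber_certificate`). Proved.
[cite: Kim2022StructureSelmer, Prop. 3.2 (PDF p. 15)] -/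
theorem natCard_localPTorsion_eq_one_iff (W : WeierstrassCurve ℚ) [W.IsElliptic] (p : ℕ)
    [Fact p.Prime] :
    Nat.card {Q : (W.baseChange ℚ_[p]).toAffine.Point // (p : ℕ) • Q = 0} = 1 ↔
      ∀ P : (W.baseChange ℚ_[p]).toAffine.Point, (p : ℤ) • P = 0 → P = 0 := by
  constructor
  · intro h P hP
    rw [natCast_zsmul] at hP
    obtain ⟨x, hx⟩ := Nat.card_eq_one_iff_exists.mp h
    have h0 := hx ⟨0, nsmul_zero _⟩
    have h1 := hx ⟨P, hP⟩
    exact congrArg Subtype.val (h1.trans h0.symm)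
  · intro h
    exact Nat.card_eq_one_iff_exists.mpr
      ⟨⟨0, nsmul_zero _⟩, fun Q ↦ Subtype.ext (h Q.1 (by rw [natCast_zsmul]; exact Q.2))⟩

/-- **B5 twin — Kim's structure theorem, clause (6), analytic rank `0`, unit Kurihara number, good or
multiplicative `p`, WITH `E(ℚ_p)[p] = 0`** (C.-H. Kim, Amer. J. Math. 148 (2026), Thm. 1.8 = arXiv
Thm. 1.9 (1), (6), Cor. 1.6, §1.3.5; verbatim statements in the module docstring of
`KuriharaNumberKimShaLength`). The statement of
`Kim2022_rankZero_padicValRat_sha_of_kuriharaNumber_ne_zero` with the one extra binder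
`Nat.card {Q ∈ E(ℚ_p) | p • Q = 0} = 1` after the surjectivity binder — the hypothesis under which the
printed proof (Thm. 3.13, §5.4.3: `x_n = u · p^t · δ̃_n`) covers a LEVEL-ONE certificate (`t = 0`;
ARM P sheet D-AUDIT-r10 cfa522325b7b7321 §D.2, flag `K26-(6)-shallow@t>0` on the sibling). Weaker than
print; nothing asserted; no `_holds` (size XL).
[cite: Kim2022StructureSelmer, Thm. 1.9 (1) and (6) (PDF pp. 7–8), Cor. 1.6 (PDF p. 6), §1.3.5, §1.4.1–1.4.4, §1.5.1, Prop. 3.2 (PDF p. 15), Thm. 3.13 (PDF p. 17)]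
[cite: Mazur1978, Cor. 4.1] [cite: GreenbergVatsal2000, §3, Remark 3.4] -/
def Kim2022_rankZero_padicValRat_sha_of_kuriharaNumber_ne_zero_of_localTorsionTrivial : Prop :=
  ∀ (W : WeierstrassCurve ℚ) [W.IsElliptic] [W.IsGloballyMinimal] (p : ℕ) [Fact p.Prime],
    5 ≤ p → (W.HasGoodReductionAtPrime p ∨ W.HasMultiplicativeReductionAtPrime p) →
    W.HasSurjectiveModNGaloisRep p →
    Nat.card {Q : (W.baseChange ℚ_[p]).toAffine.Point // (p : ℕ) • Q = 0} = 1 →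
    W.entireLFunction 1 ≠ 0 → Finite W.sha →
    ∀ {N : ℕ} [NeZero N] (f : CuspForm (Gamma0 N) 2), IsNewformOf W f →
    (∃ u : ℚ, ‖(u : ℚ_[p])‖ = 1 ∧ W.realPeriodRat = u * plusPeriod f) →
    ∀ (n : ℕ) [NeZero n], Kato.IsKolyvaginProduct W p 1 n →
    (∀ (ℓ : ℕ) [Fact ℓ.Prime], ℓ ∣ n →
      Nat.card {P : ((WeierstrassCurve.integralModelInt W).map
          (Int.castRingHom (ZMod ℓ))).toAffine.Point // p • P = 0} ≤ p) →
    ∀ ψ : (ℓ : ℕ) → (ZMod ℓ)ˣ →* Multiplicative (ZMod (p ^ 1)),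
      (∀ ℓ ∈ n.primeFactors, Function.Surjective (ψ ℓ)) →
      kuriharaNumber f (p ^ 1) n ψ ≠ 0 →
    ∃ q : ℚ, W.entireLFunction 1 / (W.realPeriodRat : ℂ) = (q : ℂ) ∧
      padicValRat p q = (padicValNat p (Nat.card (AddCommGroup.primaryComponent W.sha p)) : ℤ)

/-- Bridge B5 ⇒ B5 twin (the twin only adds a hypothesis). Proved.
[cite: Kim2022StructureSelmer, Thm. 1.9 (6) (PDF p. 8)] -/
theorem Kim2022_rankZero_padicValRat_sha_of_kuriharaNumber_ne_zero_of_localTorsionTrivial_of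
    (h : Kim2022_rankZero_padicValRat_sha_of_kuriharaNumber_ne_zero) :
    Kim2022_rankZero_padicValRat_sha_of_kuriharaNumber_ne_zero_of_localTorsionTrivial :=
  fun W _ _ p _ hp hred hsurj _ hL hfin _ _ f hf hu n _ hn hcyc ψ hψ hδ ↦
    h W p hp hred hsurj hL hfin f hf hu n hn hcyc ψ hψ hδ

/-- **B6 twin — clause (6), analytic rank `1`, unit Kurihara number at a prime level, good or
multiplicative `p`, WITH `E(ℚ_p)[p] = 0`**: the statement of
`Kim2022_rankOne_card_sha_eq_one_of_kuriharaNumber_ne_zero` with the `(t0)` binder after the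
surjectivity binder (same rationale and status as the B5 twin).
[cite: Kim2022StructureSelmer, Thm. 1.9 (1) and (6) (PDF pp. 7–8), Cor. 1.6 (PDF p. 6), §1.3.5, §1.4.1–1.4.4, §1.5.1, Prop. 3.2 (PDF p. 15), Thm. 3.13 (PDF p. 17)]
[cite: Mazur1978, Cor. 4.1] [cite: GreenbergVatsal2000, §3, Remark 3.4] -/
def Kim2022_rankOne_card_sha_eq_one_of_kuriharaNumber_ne_zero_of_localTorsionTrivial : Prop :=
  ∀ (W : WeierstrassCurve ℚ) [W.IsElliptic] [W.IsGloballyMinimal] (p : ℕ) [Fact p.Prime],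
    5 ≤ p → (W.HasGoodReductionAtPrime p ∨ W.HasMultiplicativeReductionAtPrime p) →
    W.HasSurjectiveModNGaloisRep p →
    Nat.card {Q : (W.baseChange ℚ_[p]).toAffine.Point // (p : ℕ) • Q = 0} = 1 →
    W.entireLFunction 1 = 0 → W.analyticRank = 1 → Finite W.sha →
    ∀ {N : ℕ} [NeZero N] (f : CuspForm (Gamma0 N) 2), IsNewformOf W f →
    (∃ u : ℚ, ‖(u : ℚ_[p])‖ = 1 ∧ W.realPeriodRat = u * plusPeriod f) →
    ∀ (ℓ : ℕ) [Fact ℓ.Prime], Kato.IsKolyvaginPrime W p 1 ℓ →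
    Nat.card {P : ((WeierstrassCurve.integralModelInt W).map
        (Int.castRingHom (ZMod ℓ))).toAffine.Point // p • P = 0} ≤ p →
    ∀ ψ : (ℓ' : ℕ) → (ZMod ℓ')ˣ →* Multiplicative (ZMod (p ^ 1)),
      Function.Surjective (ψ ℓ) →
      kuriharaNumber f (p ^ 1) ℓ ψ ≠ 0 →
    Nat.card (AddCommGroup.primaryComponent W.sha p) = 1

/-- Bridge B6 ⇒ B6 twin. Proved. [cite: Kim2022StructureSelmer, Thm. 1.9 (6) (PDF p. 8)] -/
theorem Kim2022_rankOne_card_sha_eq_one_of_kuriharaNumber_ne_zero_of_localTorsionTrivial_of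
    (h : Kim2022_rankOne_card_sha_eq_one_of_kuriharaNumber_ne_zero) :
    Kim2022_rankOne_card_sha_eq_one_of_kuriharaNumber_ne_zero_of_localTorsionTrivial :=
  fun W _ _ p _ hp hred hsurj _ hL hr hfin _ _ f hf hu ℓ _ hℓ hcyc ψ hψ hδ ↦
    h W p hp hred hsurj hL hr hfin f hf hu ℓ hℓ hcyc ψ hψ hδ

/-- **B7 twin — clause (6), analytic rank `0`, unit Kurihara number, ANY reduction type at `p` (Manin
datum), WITH `E(ℚ_p)[p] = 0`**: the statement of
`Kim2022_rankZero_padicValRat_sha_of_kuriharaNumber_ne_zero_of_maninConstant` with the `(t0)` binder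
after the surjectivity binder (same rationale; by Prop. 3.2 the binder excludes, among additive `p`,
exactly `p = 5` with `a₄ ≡ 10 (mod 25)` and `p = 7` with `a₆ ≡ 14 (mod 49)` on the model with
`a_i ∈ pℤ_p`). Weaker than print; nothing asserted; no `_holds`.
[cite: Kim2022StructureSelmer, Thm. 1.9 (1) and (6) (PDF pp. 7–8), §1.4.1 and §1.4.3–1.4.4 (PDF p. 7), §1.3.5 (PDF p. 6), Prop. 3.2 (PDF p. 15), Lemma 3.10 (PDF p. 17), Thm. 3.13 (PDF p. 17)]
[cite: KimNakamura2020, Thm. 1.7 with Assumption 1.1 and Remark 1.8 (1) (pp. 250–251)] -/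
def Kim2022_rankZero_padicValRat_sha_of_kuriharaNumber_ne_zero_of_maninConstant_of_localTorsionTrivial :
    Prop :=
  ∀ (W : WeierstrassCurve ℚ) [W.IsElliptic] [W.IsGloballyMinimal] (p : ℕ) [Fact p.Prime],
    5 ≤ p → W.HasSurjectiveModNGaloisRep p →
    Nat.card {Q : (W.baseChange ℚ_[p]).toAffine.Point // (p : ℕ) • Q = 0} = 1 →
    W.entireLFunction 1 ≠ 0 → Finite W.sha →
    ∀ {N : ℕ} [NeZero N] (D : ModularParametrizationData W N),
    ¬ (p : ℤ) ∣ D.maninConstant →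
    (∃ u : ℚ, ‖(u : ℚ_[p])‖ = 1 ∧ W.realPeriodRat = u * plusPeriod D.f) →
    ∀ (n : ℕ) [NeZero n], Kato.IsKolyvaginProduct W p 1 n →
    (∀ (ℓ : ℕ) [Fact ℓ.Prime], ℓ ∣ n →
      Nat.card {P : ((WeierstrassCurve.integralModelInt W).map
          (Int.castRingHom (ZMod ℓ))).toAffine.Point // p • P = 0} ≤ p) →
    ∀ ψ : (ℓ : ℕ) → (ZMod ℓ)ˣ →* Multiplicative (ZMod (p ^ 1)),
      (∀ ℓ ∈ n.primeFactors, Function.Surjective (ψ ℓ)) →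
      kuriharaNumber D.f (p ^ 1) n ψ ≠ 0 →
    ∃ q : ℚ, W.entireLFunction 1 / (W.realPeriodRat : ℂ) = (q : ℂ) ∧
      padicValRat p q = (padicValNat p (Nat.card (AddCommGroup.primaryComponent W.sha p)) : ℤ)

/-- Bridge B7 ⇒ B7 twin. Proved. [cite: Kim2022StructureSelmer, Thm. 1.9 (6) (PDF p. 8)] -/
theorem
    Kim2022_rankZero_padicValRat_sha_of_kuriharaNumber_ne_zero_of_maninConstant_of_localTorsionTrivial_of
    (h : Kim2022_rankZero_padicValRat_sha_of_kuriharaNumber_ne_zero_of_maninConstant) :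
    Kim2022_rankZero_padicValRat_sha_of_kuriharaNumber_ne_zero_of_maninConstant_of_localTorsionTrivial :=
  fun W _ _ p _ hp hsurj _ hL hfin _ _ D hc hu n _ hn hcyc ψ hψ hδ ↦
    h W p hp hsurj hL hfin D hc hu n hn hcyc ψ hψ hδ

/-- **B8 twin — clauses (1), (4), (6), analytic rank `1`, unit Kurihara number at a prime level, ANY
reduction type at `p` (Manin datum), WITH `E(ℚ_p)[p] = 0`**: the statement of
`Kim2022_rankOne_card_sha_eq_one_of_kuriharaNumber_ne_zero_of_maninConstant` with the `(t0)` binder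
after the surjectivity binder (same rationale and status as the B7 twin).
[cite: Kim2022StructureSelmer, Thm. 1.9 (1), (4) and (6) (PDF pp. 7–8), §1.4.1 and §1.4.3–1.4.4 (PDF p. 7), §1.5.1 (PDF p. 7), §1.3.5 (PDF p. 6), Prop. 3.2 (PDF p. 15), Lemma 3.10 (PDF p. 17), Thm. 3.13 (PDF p. 17)] -/
def Kim2022_rankOne_card_sha_eq_one_of_kuriharaNumber_ne_zero_of_maninConstant_of_localTorsionTrivial :
    Prop :=
  ∀ (W : WeierstrassCurve ℚ) [W.IsElliptic] [W.IsGloballyMinimal] (p : ℕ) [Fact p.Prime],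
    5 ≤ p → W.HasSurjectiveModNGaloisRep p →
    Nat.card {Q : (W.baseChange ℚ_[p]).toAffine.Point // (p : ℕ) • Q = 0} = 1 →
    W.entireLFunction 1 = 0 → W.analyticRank = 1 → Finite W.sha →
    ∀ {N : ℕ} [NeZero N] (D : ModularParametrizationData W N),
    ¬ (p : ℤ) ∣ D.maninConstant →
    (∃ u : ℚ, ‖(u : ℚ_[p])‖ = 1 ∧ W.realPeriodRat = u * plusPeriod D.f) →
    ∀ (ℓ : ℕ) [Fact ℓ.Prime], Kato.IsKolyvaginPrime W p 1 ℓ →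
    Nat.card {P : ((WeierstrassCurve.integralModelInt W).map
        (Int.castRingHom (ZMod ℓ))).toAffine.Point // p • P = 0} ≤ p →
    ∀ ψ : (ℓ' : ℕ) → (ZMod ℓ')ˣ →* Multiplicative (ZMod (p ^ 1)),
      Function.Surjective (ψ ℓ) →
      kuriharaNumber D.f (p ^ 1) ℓ ψ ≠ 0 →
    Nat.card (AddCommGroup.primaryComponent W.sha p) = 1

/-- Bridge B8 ⇒ B8 twin. Proved. [cite: Kim2022StructureSelmer, Thm. 1.9 (6) (PDF p. 8)] -/
theorem
    Kim2022_rankOne_card_sha_eq_one_of_kuriharaNumber_ne_zero_of_maninConstant_of_localTorsionTrivial_of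
    (h : Kim2022_rankOne_card_sha_eq_one_of_kuriharaNumber_ne_zero_of_maninConstant) :
    Kim2022_rankOne_card_sha_eq_one_of_kuriharaNumber_ne_zero_of_maninConstant_of_localTorsionTrivial :=
  fun W _ _ p _ hp hsurj _ hL hr hfin _ _ D hc hu ℓ _ hℓ hcyc ψ hψ hδ ↦
    h W p hp hsurj hL hr hfin D hc hu ℓ hℓ hcyc ψ hψ hδ

/-! ### The DEPTH-TWO twin of B7 (`t ≤ 1`, level `𝒩_2`) — TY-QUEUE 11c -/

/-- **B7 DEPTH-TWO twin — clause (6), analytic rank `0`, a UNIT Kurihara number at a level `n ∈ 𝒩_2`,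
ANY reduction type at `p` (Manin datum), WITH `#E(ℚ_p)[p²] ≤ p` (`t ≤ 1`)** (C.-H. Kim, Amer. J. Math.
148 (2026), Thm. 1.8 = arXiv Thm. 1.9, (1) and (6), Cor. 1.6; ARM P D-audit, reader bsd-cited-r10,
sheet `D-AUDIT-r10.md` cfa522325b7b7321 §D.2 and ADDENDUM-2 sha16 2c7193b026c59569 (P1–P3); typer
bsd-cited-ty2, TY-QUEUE 11c). The statement of
`Kim2022_rankZero_padicValRat_sha_of_kuriharaNumber_ne_zero_of_maninConstant` (B7 = registry A56) with
(i) ONE extra binder after the surjectivity binder,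
`Nat.card {Q : (W.baseChange ℚ_[p]).toAffine.Point // (p ^ 2 : ℕ) • Q = 0} ≤ p` — "`#E(ℚ_p)[p²] ≤ p`",
i.e. `t := ord_p #E(ℚ_p)[p^∞] ≤ 1` (decidable per pair; at a good or additive `p ≥ 5` it always holds,
`E(ℚ_p)[p^∞] ↪ Ẽ(𝔽_p)` resp. `E₀/E₁`, not yet a tree lemma, hence a binder) — and (ii) the level
membership deepened from `𝒩_1` to `𝒩_2 = 𝒩_{1+t}` (`Kato.IsKolyvaginProduct W p 2 n`: every `ℓ ∣ n` has
`ℓ ≡ 1` and `a_ℓ ≡ ℓ + 1 (mod p²)`); the VALUE binder is unchanged (a UNIT: `δ̃_n ≢ 0 (mod p)`, read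
with `ψ_ℓ ↠ ℤ/p`), as are the cyclicity binder and the conclusion
`ord_p(L(E,1)/Ω(W)) = ord_p #Ш(E/ℚ)(p)`. WHY THIS SHAPE (r10 §D.2 / ADDENDUM-2 P1): the printed proof sees
a certificate at a level `n` of depth `k(n)` through `x_n = u · p^t · δ̃_n ∈ ℤ_p/I_n = ℤ/p^{k(n)}`
(Thm. 3.13 = journal Thm. 3.11; §5.4.1), which is non-zero iff `ord_p δ̃_n + t < k(n)`; with `δ̃_n` a
unit and `k(n) ≥ 2 ≥ 1 + t` this holds, so the displayed argument covers EVERY row of this statement —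
in particular the `t = 1` rows (good anomalous `p` with a local point of order `p`), where the
LEVEL-ONE fact B7 is flagged `K26-(6)-shallow@t>0` and its `(t0)` twin above does not apply. This is the
binder that CONSUMES a level-two exit certificate ("`n ∈ 𝒩_2(E, p)` with `δ̃_n ≢ 0 (mod p)`",
ADDENDUM-2 P1; BSD cited-literature audit ARM P, referee A R351.5). The landed literal fact implies it
(bridge `…_of_maninConstant_depthTwo_of`, proved: `𝒩_2 ⊆ 𝒩_1`), so it is weaker than B7, hence weaker
than print; nothing asserted; no `_holds` (size XL as its siblings).
[cite: Kim2022StructureSelmer, Thm. 1.9 (1) and (6) (PDF pp. 7–8), Cor. 1.6 (PDF p. 6), §1.4.1 and §1.4.3–1.4.4 (PDF p. 7), §1.3.5 (PDF p. 6), Prop. 3.2 (PDF p. 15), Lemma 3.10 (PDF p. 17), Thm. 3.13 (PDF p. 17), §5.4.3 (PDF p. 24); journal Thm. 3.11, §5.4.1]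
[cite: KimNakamura2020, Thm. 1.7 with Assumption 1.1 and Remark 1.8 (1) (pp. 250–251)] -/
def Kim2022_rankZero_padicValRat_sha_of_kuriharaNumber_ne_zero_of_maninConstant_depthTwo : Prop :=
  ∀ (W : WeierstrassCurve ℚ) [W.IsElliptic] [W.IsGloballyMinimal] (p : ℕ) [Fact p.Prime],
    5 ≤ p → W.HasSurjectiveModNGaloisRep p →
    Nat.card {Q : (W.baseChange ℚ_[p]).toAffine.Point // (p ^ 2 : ℕ) • Q = 0} ≤ p →
    W.entireLFunction 1 ≠ 0 → Finite W.sha →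
    ∀ {N : ℕ} [NeZero N] (D : ModularParametrizationData W N),
    ¬ (p : ℤ) ∣ D.maninConstant →
    (∃ u : ℚ, ‖(u : ℚ_[p])‖ = 1 ∧ W.realPeriodRat = u * plusPeriod D.f) →
    ∀ (n : ℕ) [NeZero n], Kato.IsKolyvaginProduct W p 2 n →
    (∀ (ℓ : ℕ) [Fact ℓ.Prime], ℓ ∣ n →
      Nat.card {P : ((WeierstrassCurve.integralModelInt W).map
          (Int.castRingHom (ZMod ℓ))).toAffine.Point // p • P = 0} ≤ p) →
    ∀ ψ : (ℓ : ℕ) → (ZMod ℓ)ˣ →* Multiplicative (ZMod (p ^ 1)),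
      (∀ ℓ ∈ n.primeFactors, Function.Surjective (ψ ℓ)) →
      kuriharaNumber D.f (p ^ 1) n ψ ≠ 0 →
    ∃ q : ℚ, W.entireLFunction 1 / (W.realPeriodRat : ℂ) = (q : ℂ) ∧
      padicValRat p q = (padicValNat p (Nat.card (AddCommGroup.primaryComponent W.sha p)) : ℤ)

/-- Bridge B7 ⇒ B7 depth-two twin: the twin's hypotheses are stronger (`𝒩_2 ⊆ 𝒩_1`,
`Kato.IsKolyvaginProduct.mono`; the `t ≤ 1` binder is discarded). Proved.
[cite: Kim2022StructureSelmer, Thm. 1.9 (6) (PDF p. 8)] -/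
theorem Kim2022_rankZero_padicValRat_sha_of_kuriharaNumber_ne_zero_of_maninConstant_depthTwo_of
    (h : Kim2022_rankZero_padicValRat_sha_of_kuriharaNumber_ne_zero_of_maninConstant) :
    Kim2022_rankZero_padicValRat_sha_of_kuriharaNumber_ne_zero_of_maninConstant_depthTwo :=
  fun W _ _ p _ hp hsurj _ hL hfin _ _ D hc hu n _ hn hcyc ψ hψ hδ ↦
    h W p hp hsurj hL hfin D hc hu n (Kato.IsKolyvaginProduct.mono one_le_two hn) hcyc ψ hψ hδ

end Literature.NumberTheory.EllipticCurves

end
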